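import Summits.CriticalPhenomena.PercolationContinuityZ3.Theorems.Transplant.SkelPhiRootRoomsB
import Summits.CriticalPhenomena.PercolationContinuityZ3.Theorems.Transplant.PlanarCells2Contain
import HarnessLib

/-!
# N1 (the `{±1}` node), (R) column ((L-R1) repair, lane INBOX 2026-08-21T19:03Z): THE PLANAR DIAMETER OF THE ROOT WORLD —
# two vertices of the root world `U0root du = Q_0(0) ∪ (Btw_0(0,du) ∪ Q_0(0+du))` of the two-unit scheme `⟨cellGeomSG₂ G ψ P t Λ, q, δc⟩` (and of its small-box
# twin `cellGeomSG₂b`, NEG-SCOPE B.15) have footprints in `Cell 0 ∪ Cell (0 + du)`, hence `ψ d − ψ d' ∈ box 2 (40·rmax)`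

WHY: the rim excess of the root residue (`Skelφ.real_rootRim_le`, K–N Lemma 12) needs an excess radius for habitats of a FIXED planar diameter; v3 of the (R) chain
read the diameter off the ball (`2·Rπ`), which no excess radius can stay under (stmt-g14's located item (L-R1)); v4 (`rootOblTWAt_of_inputsG4_x/_y`) reads it off the
root world, and this file supplies the bound at the scheme of record (in the FINE map `ψ`; stmt-g14's `NegB.fine_diam_le_mR` converts `box 2 (50·rmax)` in the fine
map into `box 2 mR` in the long map).
* §1 `PCells2.sub_mem_box_of_mem_rootCells` (planar: two points of `Cell 0 ∪ Cell (0 + du)` differ by `≤ 40·rmax` on each axis);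
* §2 `Skelφ.ψ_mem_rootCells_of_mem_U0root`, **`Skelφ.ψ_sub_mem_box_of_mem_U0root`**, **`Skelφ.ψ_sub_mem_box_of_mem_U0rootb`** (the twin).

builds on p205010 (kernel theorem, internal audit signed; external expert review pending) — nothing in this file uses p205010; nothing here is a claim about the open node.
Lane `prim-bschramm`, seat `prim-bschramm-p3` (gen 10; design owner + (R) owner); helper file (`--supports stmt-CriticalPhenomena-4575 --as helper`).
[cite: KozmaNitzan2024, §4 p. 26 (Q_v, E_{v,x}), p. 28 ((32) at the root), Lemma 12 (p. 24)]
-/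

noncomputable section

open scoped Classical

namespace Summit.CriticalPhenomena.PercolationContinuityZ3.Theorems

namespace Transplant

open Literature.Probability.Percolation Literature.Probability.LatticeModels
open Literature.Probability.Percolation.KozmaNitzan
open Literature.Probability.Percolation.KozmaNitzan.Cells (oth oth_ne eq_oth_of_ne sgOf sgOf_sign stepVec_apply_fst stepVec_apply_oth)

namespace PCells2

/-! ## §1 Two points of the root cells, planar -/

/-- **Two points of `Cell 0 ∪ Cell (0 + du)` differ by at most `40·rmax` on each axis**: each coordinate lies within `10 r_i` of a centre coordinate
`c_i ∈ {0, 20 r_i · (stepVec du)_i}`, and two such centres differ by `≤ 20 r_i`. [folklore] -/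
theorem sub_mem_box_of_mem_rootCells (P : PCells2) (du : MDir) {x x' : Site 2} (hx : x ∈ P.Cell 0 ∪ P.Cell ((0 : Site 2) + stepVec du))
    (hx' : x' ∈ P.Cell 0 ∪ P.Cell ((0 : Site 2) + stepVec du)) : x - x' ∈ box 2 (40 * P.rmax) := by
  have key : ∀ {y : Site 2}, y ∈ P.Cell 0 ∪ P.Cell ((0 : Site 2) + stepVec du) →
      ∀ i, ∃ c : ℤ, (c = 0 ∨ c = 20 * (P.r i : ℤ) * stepVec du i) ∧ c - 10 * (P.r i : ℤ) ≤ y i ∧ y i ≤ c + 10 * (P.r i : ℤ) := by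
    intro y hy i
    rcases Finset.mem_union.1 hy with h | h
    · rw [PCells2.Cell, PCells2.mem_abox_iff] at h
      have := h i
      simp only [PCells2.cen_zero, Pi.zero_apply] at this
      push_cast at this
      exact ⟨0, Or.inl rfl, by linarith [this.1], by linarith [this.2]⟩
    · rw [PCells2.Cell, PCells2.mem_abox_iff] at h
      have := h i
      simp only [PCells2.cen_apply, zero_add] at this
      push_cast at this
      exact ⟨20 * (P.r i : ℤ) * stepVec du i, Or.inr rfl, by linarith [this.1], by linarith [this.2]⟩
  rw [mem_box]
  intro i
  obtain ⟨c, hc, h1, h2⟩ := key hx i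
  obtain ⟨c', hc', h1', h2'⟩ := key hx' i
  have hri : (P.r i : ℤ) ≤ P.rmax := by exact_mod_cast P.r_le_rmax i
  have hr0 : (0 : ℤ) ≤ P.r i := by positivity
  have hs : stepVec du i = 0 ∨ stepVec du i = 1 ∨ stepVec du i = -1 := by
    by_cases hi : i = du.1
    · subst hi; rw [stepVec_apply_fst]; exact Or.inr (sgOf_sign du)
    · rw [eq_oth_of_ne hi, stepVec_apply_oth]; exact Or.inl rfl
  simp only [Pi.sub_apply]
  push_cast
  rcases hs with hs | hs | hs <;> rw [hs] at hc hc' <;> rcases hc with rfl | rfl <;> rcases hc' with rfl | rfl <;>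
    constructor <;> linarith

end PCells2

namespace Skelφ

open SimpleGraph KNCells
open Literature.Barriers.CriticalPhenomena (graphBall)
open BoxProdZ2 (ConcRadiiG)

variable {V : Type} [DecidableEq V] {G : SimpleGraph V} [G.LocallyFinite] {ψ : V → Site 2}

/-! ## §2 The root world of the two-unit scheme and of its small-box twin -/

section Root

variable (P : PCells2) (t : V) (Λ : ConcRadiiG) (q : unitInterval) (δc : ℝ) (du : MDir)

/-- **Footprints of the root world**: a vertex of `U0root du = Q_0(0) ∪ (Btw_0(0,du) ∪ Q_0(0+du))` of `⟨cellGeomSG₂ G ψ P t Λ, q, δc⟩` has `ψ`-footprint in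
`Cell 0 ∪ Cell (0 + du)` (`Q_v ⊆ Cell v`, `BtwN 0 du ⊆ Cell 0 ∪ Cell (0+du)`). [cite: KozmaNitzan2024, §4 p. 26 (Q_v, E_{v,x})] -/
theorem ψ_mem_rootCells_of_mem_U0root {y : V} (hy : y ∈ (⟨cellGeomSG₂ G ψ P t Λ, q, δc⟩ : KSchA V ℕ).U0root du) :
    ψ y ∈ P.Cell 0 ∪ P.Cell ((0 : Site 2) + stepVec du) := by
  rw [KSchA.U0root, CellGeom.Ewv] at hy
  change y ∈ VWin G ψ t (P.Q 0) (Λ.rQ 0 0) ∪ (VWin G ψ t (P.BtwN 0 du) (Λ.rB 0 0 du) ∪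
    VWin G ψ t (P.Q ((0 : Site 2) + stepVec du)) (Λ.rQ 0 ((0 : Site 2) + stepVec du))) at hy
  rcases Finset.mem_union.1 hy with h | h
  · exact Finset.mem_union_left _ (P.Q_subset_Cell 0 (φ_mem_of_mem_VWin h))
  · rcases Finset.mem_union.1 h with h | h
    · exact P.BtwN_subset_Cells 0 du (φ_mem_of_mem_VWin h)
    · exact Finset.mem_union_right _ (P.Q_subset_Cell _ (φ_mem_of_mem_VWin h))

/-- **THE PLANAR DIAMETER OF THE ROOT WORLD** (two-unit scheme): `d, d' ∈ U0root du ⟹ ψ d − ψ d' ∈ box 2 (40·rmax)`.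
[cite: KozmaNitzan2024, §4 p. 28 ((32) at the root), Lemma 12 (p. 24)] -/
theorem ψ_sub_mem_box_of_mem_U0root {d d' : V} (hd : d ∈ (⟨cellGeomSG₂ G ψ P t Λ, q, δc⟩ : KSchA V ℕ).U0root du)
    (hd' : d' ∈ (⟨cellGeomSG₂ G ψ P t Λ, q, δc⟩ : KSchA V ℕ).U0root du) : ψ d - ψ d' ∈ box 2 (40 * P.rmax) :=
  P.sub_mem_box_of_mem_rootCells du (ψ_mem_rootCells_of_mem_U0root P t Λ q δc du hd) (ψ_mem_rootCells_of_mem_U0root P t Λ q δc du hd')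

/-- **THE PLANAR DIAMETER OF THE ROOT WORLD OF THE TWIN SCHEME** `cellGeomSG₂b` (its root world is that of `cellGeomSG₂`: `U0root` does not read the arrival box).
[cite: KozmaNitzan2024, §4 p. 28 ((32) at the root), Lemma 12 (p. 24)] -/
theorem ψ_sub_mem_box_of_mem_U0rootb (b₀ : Fin 2 → ℕ) {d d' : V} (hd : d ∈ (⟨cellGeomSG₂b G ψ P t Λ b₀, q, δc⟩ : KSchA V ℕ).U0root du)
    (hd' : d' ∈ (⟨cellGeomSG₂b G ψ P t Λ b₀, q, δc⟩ : KSchA V ℕ).U0root du) : ψ d - ψ d' ∈ box 2 (40 * P.rmax) := by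
  have e : (⟨cellGeomSG₂b G ψ P t Λ b₀, q, δc⟩ : KSchA V ℕ).U0root du = (⟨cellGeomSG₂ G ψ P t Λ, q, δc⟩ : KSchA V ℕ).U0root du := by
    simp only [KSchA.U0root, cellGeomSG₂b_Q, cellGeomSG₂b_Ewv, cellGeomSG₂b_a₀]; rfl
  rw [e] at hd hd'
  exact ψ_sub_mem_box_of_mem_U0root P t Λ q δc du hd hd'

end Root

end Skelφ

end Transplant

end Summit.CriticalPhenomena.PercolationContinuityZ3.Theorems

end
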